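import Literature.NumberTheory.LFunctions.Zhang2022.DHMenuConsistentWorld
import HarnessLib

/-!
# B-DH-W, the family rows dhE-05 / dhE-06 and the symmetry rows S1 / S4 of `Zhang2022.DH.MenuConsistent` on the
# (A)-world `W(D, χ)` (cell `landau-siegel`, family B-dh KILL certificate, §E staffing ls-barrier-plan 19:35:18Z)

Topic `Literature/NumberTheory/LFunctions/Zhang2022` (namespace `Literature.NumberTheory.LFunctions.Zhang2022.DH`).
Second file of ls-Bdh-typer-1 for the §E theorem `menuConsistent_holds` (E-057): it sits on top of
`DHMenuConsistentP4.lean` (typer-1: structural lemmas + rows 01/02/03/08/09/10/11/12/15/19/S3) and of ls-barrier-p4's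
`DHMenuConsistentWorld.lean` (W2–W6 world lemmas, the conjugation symmetries and `mult_symm`), and PROVES, with each
field's statement copied verbatim from `ZeroWorld.Menu`:

* `β₁(Q)` of the family over the world: `realZeroSet_world_le` (every real zero of a primitive slot of level `≤ Q` is
  `≤ β₁(D)`), `betaExc_mem_realZeroSet` / **`betaOne_world_eq`** (`β₁(Q) = β₁(D)` for `Q ≥ D`, delicate point d1 of
  `B-dh/SIGMA-E-HANDOVER.md`: `D ≤ Q ⟺ D − 1 < ⌊Q⌋₊`), **`betaOne_world_le_half`** (`β₁(Q) ≤ ½` for `Q < D`: the real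
  zeros of the family are then fence points, i.e. `⊆ {½}`);
* **`world_row05`** (TZ24 Lemma 2.4 / Cor. 2.5 pair & single / the family zero-free region minus `β₁(Q)` / Thm. 2.6 (b)
  Bordignon clause): Landau is vacuous up to `min β β′ ≤ ½ < 1 − 0.3104/log(qq′/17)` (two DISTINCT primitive quadratic
  slots cannot both carry `β₁(D)`: a primitive induced slot is `(D, χ)`, `IsExcSlot.level_eq`); Page: real zeros
  `≥ 1 − 0.1552/log Q > ½` are `β₁(D)` on `(D, χ)`; ZFR: fence zeros and `1 − β₁` have `Re ≤ ½ < 1 − 0.1037/log(…)`, the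
  zero `β₁(D)` IS `β₁(Q)`; Bordignon: `β₁(Q) = β₁(D) ≤ 1 − 100/(√D log²D)` (`DHMenuLines.bordignon_lt_delta`), and for
  `Q < D` the hypothesis `1 − zfrConst/log Q ≤ β₁(Q) ≤ ½` is absurd;
* **`world_row06`** (TZ24 Thm. 2.15): vacuous — a zero with `Re ρ > ½` at level `q ≤ Q` is `β₁(D) = β₁(Q)`;
* **`world_rowS1`** = p4's `mult_symm` with Mathlib's `DirichletCharacter.conductor_inv` and `isExcSlot_inv_iff`;
* **`world_rowS4`** (inducers): `cond(ψ.primitiveCharacter) = cond ψ` and `isExcSlot_primitiveCharacter_iff`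
  (`changeLevel_primitiveCharacter`, `changeLevel_trans`, `changeLevel_injective`).

After this file the fields of `Menu (world D χ) D χ` still open for §E are exactly `row04`, `row13`, `rowS2` (the
fence-COUNTING rows). WHAT THIS IS NOT: not `menuConsistent_holds` itself; no statement about any actual `L`-function.
«The programme SEARCHES and TYPES; no claim about Landau–Siegel zeros, Theorems 1–2 of arXiv:2211.02515 or a repaired
Margin232 until a kernel theorem says so.»

## References

* `pub/landau-siegel/B-dh/SIGMA-E-HANDOVER.md` v1.1 (rows 05, 06, S1, S4; d1–d3), `B-dh/KILL-draft.md` v1.4.1.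
* [ThornerZaman2024LogFree] Lemma 2.4, Cor. 2.5, Thm. 2.6, Thm. 2.15; [Zhang2022LandauSiegel] §2 (A);
  [MontgomeryVaughan2007] §9.1, §10.1; [BennettMartinOBryantRechnitzer2021] Thm. 1.1.
-/

noncomputable section

open scoped Classical
open Complex

namespace Literature.NumberTheory.LFunctions.Zhang2022.DH

/-- `log 3 > 1` (`e < 2.72 < 3`). [folklore] -/
private theorem one_lt_log_three' : (1 : ℝ) < Real.log 3 := by
  rw [Real.lt_log_iff_exp_lt (by norm_num)]
  exact lt_trans Real.exp_one_lt_d9 (by norm_num)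

/-! ### `β₁(Q)` of the family over the world; the family rows dhE-05 / dhE-06 -/

section WorldB

variable {D : ℕ} {χ : DirichletCharacter ℂ D} (hL : (43250 : ℝ) ≤ Real.log D)
include hL

/-- Every real zero of the family `q ≤ Q` over the world is `≤ β₁(D)` (fence real zeros are `½`, the pair is
`{β₁, 1 − β₁}`). [cite: ThornerZaman2024LogFree, §1 (1.1)] -/
theorem realZeroSet_world_le {Q β : ℝ} (hβ : β ∈ (world D χ).realZeroSet Q) : β ≤ betaExc D := by
  obtain ⟨i, -, ψ, -, hz⟩ := hβ
  rw [isZero_world_iff] at hz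
  rcases hz with hf | ⟨-, hp⟩
  · have h := fence_re hf
    rw [Complex.ofReal_re] at h
    linarith [half_lt_betaExc hL]
  · rw [mem_excPair_iff] at hp
    rcases hp with h | h
    · exact le_of_eq (by exact_mod_cast h)
    · have : β = 1 - betaExc D := by exact_mod_cast h
      linarith [half_lt_betaExc hL]

/-- For `D ≤ Q` (and `χ` primitive) the exceptional zero `β₁(D)` is a real zero of the family `q ≤ Q`.
[cite: ThornerZaman2024LogFree, §1 (1.1)] -/
theorem betaExc_mem_realZeroSet (hprim : χ.IsPrimitive) {Q : ℝ} (hDQ : (D : ℝ) ≤ Q) :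
    betaExc D ∈ (world D χ).realZeroSet Q := by
  have hD0 : D ≠ 0 := by have := three_le_of_hL hL; omega
  obtain ⟨i, hi⟩ := Nat.exists_eq_succ_of_ne_zero hD0
  subst hi
  refine ⟨i, ?_, χ, hprim, ?_⟩
  · have : i + 1 ≤ ⌊Q⌋₊ := Nat.le_floor (by exact_mod_cast hDQ)
    omega
  · unfold ZeroWorld.IsZero
    rw [mult_self_betaExc hL]
    exact Nat.one_pos

/-- **`β₁(Q) = β₁(D)` over the world once `D ≤ Q`.** [cite: ThornerZaman2024LogFree, §1 (1.1)] -/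
theorem betaOne_world_eq (hprim : χ.IsPrimitive) {Q : ℝ} (hDQ : (D : ℝ) ≤ Q) :
    (world D χ).betaOne Q = betaExc D := by
  unfold ZeroWorld.betaOne
  exact IsGreatest.csSup_eq ⟨betaExc_mem_realZeroSet hL hprim hDQ, fun β hβ => realZeroSet_world_le hL hβ⟩

omit hL in
/-- For `Q < D` the family `q ≤ Q` has real zeros only at `½` (if any): `β₁(Q) ≤ ½`.
[cite: ThornerZaman2024LogFree, §1 (1.1)] -/
theorem betaOne_world_le_half (χ : DirichletCharacter ℂ D) {Q : ℝ} (hQD : Q < D) :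
    (world D χ).betaOne Q ≤ 1 / 2 := by
  have hsub : (world D χ).realZeroSet Q ⊆ {1 / 2} := by
    intro β hβ
    obtain ⟨i, hi, ψ, -, hz⟩ := hβ
    rw [isZero_world_iff] at hz
    rcases hz with hf | ⟨hs, -⟩
    · have h := fence_re hf
      rw [Complex.ofReal_re] at h
      exact h
    · exfalso
      haveI : NeZero (i + 1) := ⟨Nat.succ_ne_zero i⟩
      have h1 : (D : ℝ) ≤ ((i + 1 : ℕ) : ℝ) := hs.cast_le
      have hQ0 : 0 ≤ Q := by
        by_contra hneg
        push Not at hneg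
        have : ⌊Q⌋₊ = 0 := Nat.floor_eq_zero.mpr (by linarith)
        omega
      have h2 : ((i + 1 : ℕ) : ℝ) ≤ Q :=
        le_trans (by exact_mod_cast (show i + 1 ≤ ⌊Q⌋₊ by omega)) (Nat.floor_le hQ0)
      linarith
  unfold ZeroWorld.betaOne
  rcases Set.subset_singleton_iff_eq.mp hsub with h | h
  · rw [h, Real.sSup_empty]; norm_num
  · rw [h, csSup_singleton]

/-- **Row dhE-06 on the world (TZ24 Thm. 2.15, explicit family DH): VACUOUS** — a zero with `Re ρ > ½` of a
slot `q ≤ Q` is `β₁(D)` with `D ≤ q ≤ Q`, hence equals `β₁(Q)`. [cite: ThornerZaman2024LogFree, Theorem 2.15] -/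
theorem world_row06 (hprim : χ.IsPrimitive) : ∀ Q T : ℝ, 400000 < Q → 1 ≤ T →
    1 - ThornerZaman2024.zfrConst / Real.log Q ≤ (world D χ).betaOne Q →
    ∀ (q : ℕ) [NeZero q] (ψ : DirichletCharacter ℂ q), (q : ℝ) ≤ Q → ψ.IsPrimitive →
      ∀ ρ : ℂ, ρ ≠ 1 → ρ ≠ (((world D χ).betaOne Q : ℝ) : ℂ) → (world D χ).IsZero q ψ ρ →
        1 / 2 < ρ.re → |ρ.im| ≤ T → ρ.re ≤ ThornerZaman2024.dhBound Q T ((world D χ).betaOne Q) := by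
  intro Q T _ _ _ q _ ψ hqQ _ ρ _ hρβ hz hre _
  exfalso
  obtain ⟨hs, rfl⟩ := re_gt_half_zero hL hz hre
  rw [betaOne_world_eq hL hprim (le_trans hs.cast_le hqQ)] at hρβ
  exact hρβ rfl

/-- **Row dhE-05 on the world (TZ24 Lemma 2.4 / Cor. 2.5 / Thm. 2.6 a, b: the Landau–Page family rows).**
(a) Landau: two real zeros of DISTINCT primitive quadratic slots cannot both exceed `½` (a real zero `> ½` is
`β₁(D)` on an induced slot, and a primitive induced slot is `(D, χ)`), and `½ < 1 − 0.3104/log(qq′/17)`.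
(b) Page: real zeros `≥ 1 − 0.1552/log Q > ½` are `β₁(D)` on `(D, χ)`. (c) the family zero-free region minus
`β₁(Q)`: zeros with `Re ρ ≤ ½` are below `1 − 0.1037/log(…)`, and the one zero with `Re ρ > ½` is `β₁(Q)`.
(d) the Bordignon clause: `β₁(Q) = β₁(D) ≤ 1 − 100/(√D log²D)` (`bordignon_lt_delta`), `D > 4·10⁵`; for
`Q < D`, `β₁(Q) ≤ ½` contradicts the hypothesis. [cite: ThornerZaman2024LogFree, Theorem 2.6] -/
theorem world_row05 (hprim : χ.IsPrimitive) :
    (∀ (q q' : ℕ) [NeZero q] [NeZero q'] (ψ : DirichletCharacter ℂ q) (ψ' : DirichletCharacter ℂ q'),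
      400000 < q → 400000 < q' → ψ.IsPrimitive → ψ.IsQuadratic → ψ'.IsPrimitive → ψ'.IsQuadratic →
        (q ≠ q' ∨ ∃ h : q = q', h ▸ ψ ≠ ψ') →
          ∀ β β' : ℝ, (world D χ).IsZero q ψ β → (world D χ).IsZero q' ψ' β' →
            min β β' < 1 - ThornerZaman2024.landauConst / Real.log ((q' : ℝ) * q / 17)) ∧
    (∀ Q : ℝ, 3 ≤ Q →
      (∀ (q q' : ℕ) [NeZero q] [NeZero q'] (ψ : DirichletCharacter ℂ q) (ψ' : DirichletCharacter ℂ q'),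
        (q : ℝ) ≤ Q → (q' : ℝ) ≤ Q → ψ.IsPrimitive → ψ.IsQuadratic → ψ'.IsPrimitive → ψ'.IsQuadratic →
          ∀ β β' : ℝ, (world D χ).IsZero q ψ β → (world D χ).IsZero q' ψ' β' →
            1 - ThornerZaman2024.pageConst / Real.log Q ≤ β → 1 - ThornerZaman2024.pageConst / Real.log Q ≤ β' →
              β = β' ∧ ∃ h : q = q', h ▸ ψ = ψ') ∧
      (∀ (q : ℕ) [NeZero q] (ψ : DirichletCharacter ℂ q), (q : ℝ) ≤ Q → ψ.IsPrimitive → ψ.IsQuadratic →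
        ∀ β : ℝ, (world D χ).IsZero q ψ β → 1 - ThornerZaman2024.pageConst / Real.log Q ≤ β → 400000 < q)) ∧
    (∀ Q : ℝ, 3 ≤ Q → ∀ (q : ℕ) [NeZero q] (ψ : DirichletCharacter ℂ q), (q : ℝ) ≤ Q → ψ.IsPrimitive →
      ∀ ρ : ℂ, ρ ≠ 1 → ρ ≠ (((world D χ).betaOne Q : ℝ) : ℂ) → (world D χ).IsZero q ψ ρ →
        ρ.re < 1 - ThornerZaman2024.zfrConst / Real.log (max Q (Q * |ρ.im|))) ∧
    (∀ Q : ℝ, 3 ≤ Q → 1 - ThornerZaman2024.zfrConst / Real.log Q ≤ (world D χ).betaOne Q →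
      400000 < Q ∧ ∃ (q₁ : ℕ) (_ : NeZero q₁) (χ₁ : DirichletCharacter ℂ q₁),
        400000 < q₁ ∧ (q₁ : ℝ) ≤ Q ∧ χ₁.IsPrimitive ∧ (world D χ).IsZero q₁ χ₁ ((world D χ).betaOne Q) ∧
          (world D χ).betaOne Q ≤ 1 - 100 / (Real.sqrt q₁ * Real.log q₁ ^ 2)) := by
  have hlc := ThornerZaman2024.landauConst_bounds
  have hpc := ThornerZaman2024.pageConst_bounds
  have hzc := ThornerZaman2024.zfrConst_bounds
  have hlog3 : ∀ x : ℝ, 3 ≤ x → 1 < Real.log x := fun x hx =>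
    lt_of_lt_of_le one_lt_log_three' (Real.log_le_log (by norm_num) hx)
  refine ⟨?_, ?_, ?_, ?_⟩
  · -- (a) Landau
    intro q q' _ _ ψ ψ' hq hq' hp _ hp' _ hdist β β' hz hz'
    have hmin : min β β' ≤ 1 / 2 := by
      by_contra H
      push Not at H
      have hβ : 1 / 2 < β := lt_of_lt_of_le H (min_le_left _ _)
      have hβ' : 1 / 2 < β' := lt_of_lt_of_le H (min_le_right _ _)
      obtain ⟨hs, -⟩ := real_zero_gt_half hL hz hβ
      obtain ⟨hs', -⟩ := real_zero_gt_half hL hz' hβ'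
      have hqD : q = D := hs.level_eq hprim hp
      have hq'D : q' = D := hs'.level_eq hprim hp'
      rcases hdist with hne | ⟨h, hne⟩
      · exact hne (hqD.trans hq'D.symm)
      · subst h
        exact hne (hs.eq_of_eq hs')
    have hx : (3 : ℝ) ≤ (q' : ℝ) * q / 17 := by
      have h1 : (400000 : ℝ) < q := by exact_mod_cast hq
      have h2 : (400000 : ℝ) < q' := by exact_mod_cast hq'
      nlinarith
    have hl := hlog3 _ hx
    have h3 : ThornerZaman2024.landauConst / Real.log ((q' : ℝ) * q / 17) <
        ThornerZaman2024.landauConst / 1 :=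
      div_lt_div_of_pos_left (by linarith [hlc.1]) (by norm_num) hl
    calc min β β' ≤ 1 / 2 := hmin
      _ < 1 - ThornerZaman2024.landauConst / Real.log ((q' : ℝ) * q / 17) := by linarith [hlc.2]
  · -- (b) Page
    intro Q hQ
    have hl := hlog3 Q hQ
    have hth : 1 / 2 < 1 - ThornerZaman2024.pageConst / Real.log Q := by
      have : ThornerZaman2024.pageConst / Real.log Q < ThornerZaman2024.pageConst / 1 :=
        div_lt_div_of_pos_left (by linarith [hpc.1]) (by norm_num) hl
      linarith [hpc.2]
    refine ⟨?_, ?_⟩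
    · intro q q' _ _ ψ ψ' _ _ hp _ hp' _ β β' hz hz' hβ hβ'
      obtain ⟨hs, hβe⟩ := real_zero_gt_half hL hz (by linarith)
      obtain ⟨hs', hβe'⟩ := real_zero_gt_half hL hz' (by linarith)
      have hqD : q = D := hs.level_eq hprim hp
      have hq'D : q' = D := hs'.level_eq hprim hp'
      have hqq : q = q' := hqD.trans hq'D.symm
      subst hqq
      exact ⟨by rw [hβe, hβe'], rfl, hs.eq_of_eq hs'⟩
    · intro q _ ψ _ hp _ β hz hβ
      obtain ⟨hs, -⟩ := real_zero_gt_half hL hz (by linarith)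
      rw [hs.level_eq hprim hp]
      exact nat_400000_lt_of_hL hL
  · -- (c) the family zero-free region minus `β₁(Q)`
    intro Q hQ q _ ψ hqQ _ ρ _ hρβ hz
    have hl := hlog3 Q hQ
    have hQ0 : 0 < Q := by linarith
    have hlogmax : 1 < Real.log (max Q (Q * |ρ.im|)) :=
      lt_of_lt_of_le hl (Real.log_le_log hQ0 (le_max_left _ _))
    have hth : 1 / 2 < 1 - ThornerZaman2024.zfrConst / Real.log (max Q (Q * |ρ.im|)) := by
      have : ThornerZaman2024.zfrConst / Real.log (max Q (Q * |ρ.im|)) < ThornerZaman2024.zfrConst / 1 :=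
        div_lt_div_of_pos_left (by linarith [hzc.1]) (by norm_num) hlogmax
      linarith [hzc.2]
    by_cases hre : 1 / 2 < ρ.re
    · exfalso
      obtain ⟨hs, rfl⟩ := re_gt_half_zero hL hz hre
      rw [betaOne_world_eq hL hprim (le_trans hs.cast_le hqQ)] at hρβ
      exact hρβ rfl
    · push Not at hre
      linarith
  · -- (d) the Bordignon clause
    intro Q hQ hβQ
    have hl := hlog3 Q hQ
    by_cases hDQ : (D : ℝ) ≤ Q
    · have hβ1 := betaOne_world_eq hL hprim hDQ
      have hD4 := nat_400000_lt_of_hL hL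
      have hD4r : (400000 : ℝ) < D := by exact_mod_cast hD4
      haveI : NeZero D := ⟨by omega⟩
      refine ⟨by linarith, D, inferInstance, χ, hD4, hDQ, hprim, ?_, ?_⟩
      · rw [hβ1]
        unfold ZeroWorld.IsZero
        rw [mult_self_betaExc hL]
        exact Nat.one_pos
      · rw [hβ1, sqrt_cast_eq_exp hL]
        have hB := DHMenuLines.bordignon_lt_delta hL
        have hB' : 100 * Real.exp (-(Real.log D / 2)) / Real.log D ^ 2 =
            100 / (Real.exp (Real.log D / 2) * Real.log D ^ 2) := by
          rw [Real.exp_neg]; field_simp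
        have hδ := one_sub_betaExc D
        linarith
    · exfalso
      push Not at hDQ
      have h1 := betaOne_world_le_half χ hDQ
      have : ThornerZaman2024.zfrConst / Real.log Q < ThornerZaman2024.zfrConst / 1 :=
        div_lt_div_of_pos_left (by linarith [hzc.1]) (by norm_num) hl
      linarith [hzc.2]

end WorldB

/-! ### The symmetry rows S1 (conjugation / reflection) and S4 (inducers) over the world -/

section WorldC

variable {D : ℕ} {χ : DirichletCharacter ℂ D}

/-- **Row S1 on the world**: the zero data of `ψ̄ = ψ⁻¹` are the conjugates of those of `ψ` (`cond ψ̄ = cond ψ`,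
the fence and the real pair are conjugation-symmetric, induced slots are inversion-stable for quadratic `χ`), and
every slot is closed under `ρ ↦ 1 − ρ̄` — ls-barrier-p4's `mult_symm` with its two side conditions discharged.
[cite: MontgomeryVaughan2007, §10.1] -/
theorem world_rowS1 (hquad : χ.IsQuadratic) : ∀ (q : ℕ) (ψ : DirichletCharacter ℂ q) (ρ : ℂ),
    (world D χ).mult q ψ⁻¹ (starRingEnd ℂ ρ) = (world D χ).mult q ψ ρ ∧
      (world D χ).mult q ψ (1 - starRingEnd ℂ ρ) = (world D χ).mult q ψ ρ :=
  fun _ ψ ρ => mult_symm χ ψ ρ (DirichletCharacter.conductor_inv ψ) (isExcSlot_inv_iff hquad)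

/-- The primitive inducer of a slot is an induced slot iff the slot is (for primitive `χ`).
[cite: MontgomeryVaughan2007, §9.1] -/
theorem isExcSlot_primitiveCharacter_iff (hprim : χ.IsPrimitive) {q : ℕ} [NeZero q]
    (ψ : DirichletCharacter ℂ q) :
    IsExcSlot D χ ψ.conductor ψ.primitiveCharacter ↔ IsExcSlot D χ q ψ := by
  constructor
  · rintro ⟨h, hp⟩
    refine ⟨dvd_trans h ψ.conductor_dvd_level, ?_⟩
    rw [DirichletCharacter.changeLevel_trans χ h ψ.conductor_dvd_level, ← hp,
      DirichletCharacter.changeLevel_primitiveCharacter]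
  · intro hs
    have hc : ψ.conductor = D := hs.conductor_eq hprim
    obtain ⟨h, hψ⟩ := hs
    have h' : D ∣ ψ.conductor := dvd_of_eq hc.symm
    refine ⟨h', ?_⟩
    apply DirichletCharacter.changeLevel_injective ψ.conductor_dvd_level
    rw [DirichletCharacter.changeLevel_primitiveCharacter, ← DirichletCharacter.changeLevel_trans χ h' ψ.conductor_dvd_level]
    exact hψ

/-- **Row S4 on the world**: a slot carries exactly the zeros of its primitive inducer (the fence depends only on
the conductor, `cond(ψ.primitiveCharacter) = cond ψ`; induced slots correspond). [cite: MontgomeryVaughan2007, §9.1] -/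
theorem world_rowS4 (hprim : χ.IsPrimitive) : ∀ (q : ℕ) [NeZero q] (ψ : DirichletCharacter ℂ q) (ρ : ℂ),
    ((world D χ).IsZero ψ.conductor ψ.primitiveCharacter ρ → (world D χ).IsZero q ψ ρ) ∧
      ((world D χ).IsZero q ψ ρ → (world D χ).IsZero ψ.conductor ψ.primitiveCharacter ρ ∨ ρ.re = 0) := by
  intro q _ ψ ρ
  have hcond : ψ.primitiveCharacter.conductor = ψ.conductor :=
    (DirichletCharacter.isPrimitive_def _).mp (DirichletCharacter.primitiveCharacter_isPrimitive ψ)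
  have key : (world D χ).IsZero ψ.conductor ψ.primitiveCharacter ρ ↔ (world D χ).IsZero q ψ ρ := by
    rw [isZero_world_iff, isZero_world_iff, hcond, isExcSlot_primitiveCharacter_iff hprim]
  exact ⟨key.mp, fun h => Or.inl (key.mpr h)⟩

end WorldC

/-! ### The assembly modulo the fence-counting rows -/

section Assembly

/-- **The assembly, modulo the three fence-counting rows (appended 2026-08-26T20:2xZ).** `MenuConsistent` follows
from the sixteen field theorems of `DHChainBarrier` / `DHMenuConsistentP4` / `DHMenuConsistentP4B` once the three
remaining fields are supplied as theorems of the same verbatim shape: `row04` (TZ24 Thm. 1.2 / Cor. 6.1 counts of the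
world's family), `row13` (BMOR's Riemann–von Mangoldt band for the fence) and `rowS2` (monotone counts) — the §E stubs
of ls-barrier-p1 / -p4 / -p5. This pins the final `Menu` constructor (every other field := its theorem) and shows the
sixteen field theorems have exactly the field types. NOT `menuConsistent_holds`: the three hypotheses are genuine
open proof obligations, stated here exactly as the fields read. [cite: Zhang2022LandauSiegel, §2 Assumption (A)] -/
theorem menuConsistent_of_fenceRows
    (h04 : ∀ (D : ℕ) (χ : DirichletCharacter ℂ D), χ.IsPrimitive → (43250 : ℝ) ≤ Real.log D →
      (∀ Q : ℝ, 3 ≤ Q → ∀ σ : ℝ, 39 / 40 ≤ σ →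
        ((world D χ).zeroCount σ Q : ℝ) ≤ 10 ^ 88 * (10 ^ 421 * Q ^ 99) ^ (1 - σ) ∧
          ((world D χ).zeroCountExcl σ Q : ℝ) ≤
            10 ^ 93 * min 1 ((1 - (world D χ).betaOne Q) * Real.log Q) * (10 ^ 466 * Q ^ 170) ^ (1 - σ)) ∧
      (∀ Q : ℝ, 3 ≤ Q → ∀ σ : ℝ, 0 ≤ σ →
        ((world D χ).zeroCount σ Q : ℝ) ≤ 10 ^ 88 * (10 ^ 421 * Q ^ 127) ^ (1 - σ) ∧
          ((world D χ).zeroCountExcl σ Q : ℝ) ≤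
            10 ^ 93 * min 1 ((1 - (world D χ).betaOne Q) * Real.log Q) * (10 ^ 466 * Q ^ 198) ^ (1 - σ)))
    (h13 : ∀ (D : ℕ) (χ : DirichletCharacter ℂ D), χ.IsPrimitive → (43250 : ℝ) ≤ Real.log D →
      ∀ (q : ℕ) [NeZero q], 1 < q → ∀ ψ : DirichletCharacter ℂ q, ψ.IsPrimitive → ∀ T : ℝ, 5 / 7 ≤ T →
        (bmorEll q T ≤ 1.567 → (world D χ).stripCount q ψ T = 0) ∧
        (1.567 < bmorEll q T →
          |((world D χ).stripCount q ψ T : ℝ) -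
              (T / Real.pi * Real.log (q * T / (2 * Real.pi * Real.exp 1)) - (-1) ^ charParity ψ / 4)| ≤
            0.22737 * bmorEll q T + 2 * Real.log (1 + bmorEll q T) - 0.5))
    (hS2 : ∀ (D : ℕ) (χ : DirichletCharacter ℂ D), (43250 : ℝ) ≤ Real.log D →
      ∀ (q : ℕ) (ψ : DirichletCharacter ℂ q) (σ σ' T T' : ℝ), σ' ≤ σ → T ≤ T' →
        (world D χ).stripCount q ψ T ≤ (world D χ).stripCount q ψ T' ∧
          (world D χ).charZeroCountRe q ψ σ T ≤ (world D χ).charZeroCountRe q ψ σ' T') :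
    MenuConsistent := by
  intro D _ χ hprim hquad hχ hL
  exact
    { assumptionA := world_assumptionA (log_pos_of_hL hL) χ
      row01 := world_row01 hL
      row02 := world_row02 hL
      row03 := world_row03
      row04 := h04 D χ hprim hL
      row05 := world_row05 hL hprim
      row06 := world_row06 hL hprim
      row08 := world_row08 hL hχ hquad
      row09 := world_row09 hL
      row10 := world_row10 hL
      row11 := world_row11 hL
      row12 := world_row12 hL hquad
      row13 := h13 D χ hprim hL
      row15 := world_row15 hL
      row19 := world_row19 hL
      rowS1 := world_rowS1 hquad
      rowS2 := hS2 D χ hL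
      rowS3 := world_rowS3 hL hquad
      rowS4 := world_rowS4 hprim }

end Assembly

end Literature.NumberTheory.LFunctions.Zhang2022.DH

end
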